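import Summits.QuantumAdvantage.QuantumAdvantage.Theorems.LinnikCubicClassGroupsDegreeOnePrimesEscapeRayClassDegOne
import Literature.NumberTheory.GaloisRepresentations.ArtinHomFunctoriality
import Literature.NumberTheory.GaloisRepresentations.ArtinCharacterReciprocityProofs
import Mathlib.GroupTheory.FiniteAbelian.Duality
import HarnessLib

/-!
# Linnik's theorem for cosets of a congruence class group, XI: the Chebotarev–Linnik theorem for ABELIAN
# extensions with an exponent depending only on the base field

Topic `Summits/QuantumAdvantage/QuantumAdvantage/Theorems`, cell B2b-1 (linnik-cubic), PART A (gen 23); helper toward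
the crux `DegreeOnePrimesEscape` (stmt-QuantumAdvantage-11543) of route `LinnikCubicClassGroups`.  HONEST FRAMING: the
value of this file is a THEOREM (kernel-checked, GRH-free, Siegel-free) — NOT summit progress (the route still rests on
the hypothesis-type target `PureCubicClassNumberHard`).

Let `N/K` be a finite Galois extension of number fields with COMMUTATIVE Galois group, `[K:ℚ] = n > 1`, and let
`𝔪 ≠ 0` be an ideal of `𝓞 K` modulo which the Artin symbol of `N/K` is defined, i.e. every character `χ` of
`Gal(N/K)` composed with the Frobenius `𝔭 ↦ Frob_𝔭` gives an Artin symbol killing the ray `P_K^𝔪`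
(`ArtinKillsRay 𝔪 (χ ∘ galFrob K N)` — Artin reciprocity for a congruence class group `mod 𝔪` cutting out `N`; in
the tree this is PROVED for cyclic `N/K` and the admissible modulus `IdeleHerbrand.admissibleModulus K N`,
`artinKillsRay_of_finrank_le_relIndex` + `IdeleHerbrand.finrank_le_relIndex_ray_sup_normSubgroup`).  Then:
* `exists_degOnePrime_galFrob_eq` — **every `σ ∈ Gal(N/K)` is the Frobenius `galFrob K N 𝔭` of a prime `𝔭 ∤ 𝔪` of
  `K` of RESIDUE DEGREE ONE with `N𝔭 ≤ (|d_K| n^n N𝔪)^{L(n)}`** — the exponent depends only on the degree `n`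
  of the BASE field, not on `[N:K]` (Weiss 1983 §6 / Thorner–Zaman 2017 Thm 3.1 shape for abelian extensions; the
  tree's Lagarias–Montgomery–Odlyzko-type bounds `exists_prime_isArithFrobAt_le_relative` have exponent `L([N:ℚ])`
  and base `|d_N|`);
* `exists_degOnePrime_frobenius_eq` — if moreover every prime ramified in `N` divides `𝔪`, the prime `𝔭` is
  unramified in `N` and EVERY arithmetic Frobenius at EVERY prime of `N` above `𝔭` equals `σ`;
* `exists_degOnePrime_frobenius_eq_of_isCyclic` — **the cyclic case, UNCONDITIONAL** (Artin reciprocity for the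
  admissible modulus is a tree theorem): for `N/K` cyclic, every `σ` is the Frobenius of an unramified degree-one
  prime `𝔭 ∤ 𝔪_{N/K}` with `N𝔭 ≤ (|d_K| n^n N𝔪_{N/K})^{L(n)}`, `𝔪_{N/K} = IdeleHerbrand.admissibleModulus K N`
  (supported exactly on the ramified primes).
Proof: `Gal(N/K)` with the Frobenius datum `galFrob K N` is an abelian Frobenius datum killing the narrow ray
`mod 𝔪` (characters of a finite abelian group separate points, Mathlib
`CommGroup.exists_apply_ne_one_of_hasEnoughRootsOfUnity`), its non-trivial characters are non-principal off `𝔪`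
(the Frobenii off any finite set generate, `closure_frobenius_eq_top`), and `|Gal(N/K)| ≤ |Cl_K^𝔪| ≤ Q_𝔪⁴` (the
Artin map `rayClassArtinHom` is onto, `exists_mem_idealsPrimeTo_artinHom_eq`; `natCard_rayClassGroup_le_rayCondQ_pow`);
then `exists_degOnePrime_fiber_absNorm_le` (file X) applies.
References: A. Weiss, J. reine angew. Math. 338 (1983), §6 [Weiss1983]; J. Thorner, A. Zaman, ANT 11 (2017), Thm 3.1
[ThornerZaman2017]; N. Childress, Class Field Theory (2009), Ch. 5 Thm 2.1 [Childress2009].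
-/

noncomputable section

open Complex Real Set Filter Topology NumberField IsDedekindDomain
open scoped NumberField nonZeroDivisors

namespace Summit.QuantumAdvantage.QuantumAdvantage.Theorems.DegreeOnePrimesEscape

open Literature.NumberTheory.LFunctions Literature.NumberTheory.LFunctions.NumberField
  Literature.NumberTheory.LFunctions.AbelianDensity Literature.NumberTheory.GaloisRepresentations
open scoped Classical

/-- **The Chebotarev–Linnik theorem for abelian extensions with base-field exponent, degree-one primes** (see the
module docstring): for `n > 1` there is `L = L(n) > 0` such that for every number field `K` of degree `n`, every
finite Galois `N/K` with commutative group, every `𝔪 ≠ 0` modulo which the Artin symbol of `N/K` is defined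
(`ArtinKillsRay 𝔪 (χ ∘ galFrob K N)` for all characters `χ`), and every `σ ∈ Gal(N/K)`, there is a prime `𝔭 ∤ 𝔪`
of `K` with `galFrob K N 𝔭 = σ`, `N𝔭` a rational prime, and `N𝔭 ≤ (|d_K| n^n N𝔪)^L`.
[cite: Weiss1983, §6] [cite: ThornerZaman2017, Theorem 3.1] -/
theorem exists_degOnePrime_galFrob_eq (n : ℕ) (hn : 1 < n) :
    ∃ L : ℝ, 0 < L ∧ ∀ (K : Type) [Field K] [NumberField K], Module.finrank ℚ K = n →
    ∀ (N : Type) [Field N] [NumberField N] [Algebra K N] [IsGalois K N],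
      (∀ a b : N ≃ₐ[K] N, Commute a b) →
    ∀ (𝔪 : Ideal (𝓞 K)), 𝔪 ≠ ⊥ →
      (∀ χ : (N ≃ₐ[K] N) →* ℂˣ, ArtinKillsRay 𝔪 (fun v ↦ χ (galFrob K N v))) →
      ∀ σ : N ≃ₐ[K] N, ∃ v : HeightOneSpectrum (𝓞 K), ¬ 𝔪 ≤ v.asIdeal ∧ galFrob K N v = σ ∧
        (Ideal.absNorm v.asIdeal).Prime ∧ (Ideal.absNorm v.asIdeal : ℝ) ≤ rayCondQ K 𝔪 ^ L := by
  obtain ⟨L, hL, h⟩ := exists_degOnePrime_fiber_absNorm_le n hn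
  refine ⟨L, hL, fun K _ _ hKn N _ _ _ _ hcomm 𝔪 h𝔪 hray σ ↦ ?_⟩
  haveI : FiniteDimensional K N := Module.Finite.of_restrictScalars_finite ℚ K N
  letI : CommGroup (N ≃ₐ[K] N) :=
    { (inferInstance : Group (N ≃ₐ[K] N)) with mul_comm := fun a b ↦ (hcomm a b).eq }
  have hK : 1 < Module.finrank ℚ K := by rw [hKn]; exact hn
  -- (1) the Frobenius datum kills the narrow ray `mod 𝔪` (characters separate points)
  have hrayG : ArtinKillsRay 𝔪 (galFrob K N) := by
    intro b c hb hc hcop hbc hpos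
    have hb' : (Ideal.span {b} : Ideal (𝓞 K)) ≠ ⊥ := by simpa [Ideal.span_singleton_eq_bot] using hb
    have hc' : (Ideal.span {c} : Ideal (𝓞 K)) ≠ ⊥ := by simpa [Ideal.span_singleton_eq_bot] using hc
    by_contra hne
    have hne' : artinSymbol (galFrob K N) (Ideal.span {b}) *
        (artinSymbol (galFrob K N) (Ideal.span {c}))⁻¹ ≠ 1 := by
      rwa [Ne, mul_inv_eq_one]
    haveI : NeZero ((Monoid.exponent (N ≃ₐ[K] N) : ℕ) : ℂ) :=
      ⟨Nat.cast_ne_zero.mpr Monoid.exponent_ne_zero_of_finite⟩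
    obtain ⟨χ, hχ⟩ := CommGroup.exists_apply_ne_one_of_hasEnoughRootsOfUnity (N ≃ₐ[K] N) ℂ hne'
    apply hχ
    have e := hray χ b c hb hc hcop hbc hpos
    rw [map_mul, map_inv, map_artinSymbol χ _ hb', map_artinSymbol χ _ hc', Function.comp_def, e,
      mul_inv_cancel]
  -- (2) non-trivial characters are non-principal off `𝔪` (the Frobenii off a finite set generate)
  have hsep : ∀ ψ : AddChar (Additive (N ≃ₐ[K] N)) ℂ, ψ ≠ 0 →
      ∃ v : HeightOneSpectrum (𝓞 K), ¬ 𝔪 ≤ v.asIdeal ∧ ψ (Additive.ofMul (galFrob K N v)) ≠ 1 := by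
    intro ψ hψ
    by_contra hall
    push Not at hall
    apply hψ
    set B : Set (HeightOneSpectrum (𝓞 K)) :=
      {v | 𝔪 ≤ v.asIdeal} ∪ {v | ¬ Algebra.IsUnramifiedIn (𝓞 N) v.asIdeal} with hB
    have hBfin : B.Finite := by
      refine Set.Finite.union ?_ (finite_setOf_not_isUnramifiedIn K N)
      refine (Ideal.finite_factors h𝔪).subset fun v hv ↦ ?_
      exact Ideal.dvd_iff_le.mpr hv
    have hgen := closure_frobenius_eq_top hcomm hBfin
    have hker : ∀ τ : N ≃ₐ[K] N, ψ (Additive.ofMul τ) = 1 := by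
      intro τ
      have hτ : τ ∈ Subgroup.closure {φ : N ≃ₐ[K] N | ∃ v : HeightOneSpectrum (𝓞 K), v ∉ B ∧
          ∃ Q ∈ v.asIdeal.primesOver (𝓞 N), IsArithFrobAt (𝓞 K) φ Q} := by
        rw [hgen]; exact Subgroup.mem_top τ
      induction hτ using Subgroup.closure_induction with
      | mem φ hφ =>
        obtain ⟨v, hvB, Q, hQ, hφQ⟩ := hφ
        simp only [hB, Set.mem_union, Set.mem_setOf_eq, not_or, not_not] at hvB
        rw [eq_galFrob hcomm hvB.2 hQ hφQ]
        exact hall v hvB.1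
      | one => rw [ofMul_one, AddChar.map_zero_eq_one]
      | mul φ φ' _ _ h1 h2 => rw [ofMul_mul, AddChar.map_add_eq_mul, h1, h2, one_mul]
      | inv φ _ h1 => rw [ofMul_inv, AddChar.map_neg_eq_inv, h1, inv_one]
    exact DFunLike.ext ψ 0 fun a ↦ by rw [AddChar.zero_apply]; exact hker (Additive.toMul a)
  -- (3) `|Gal(N/K)| ≤ |Cl_K^𝔪| ≤ Q_𝔪⁴` (the Artin map on the ray class group is onto)
  haveI : Finite (RayClassGroup 𝔪) := finite_rayClassGroup h𝔪
  have hsurj : Function.Surjective (rayClassArtinHom h𝔪 hrayG) := by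
    intro τ
    obtain ⟨𝔅, h𝔅, e⟩ := exists_mem_idealsPrimeTo_artinHom_eq hcomm (MonoidHom.id (N ≃ₐ[K] N)) h𝔪 τ
    refine ⟨QuotientGroup.mk ⟨𝔅, h𝔅⟩, ?_⟩
    rw [rayClassArtinHom_mk]
    simpa only [MonoidHom.id_apply] using e
  have hG : (Nat.card (N ≃ₐ[K] N) : ℝ) ≤ rayCondQ K 𝔪 ^ (4 : ℕ) :=
    le_trans (by exact_mod_cast Nat.card_le_card_of_surjective _ hsurj)
      (natCard_rayClassGroup_le_rayCondQ_pow hK h𝔪)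
  -- (4) the coset theorem
  exact h K hKn (N ≃ₐ[K] N) 𝔪 (galFrob K N) h𝔪 hrayG hsep hG σ

/-- **The Chebotarev–Linnik theorem for abelian extensions, Frobenius form**: under the hypotheses of
`exists_degOnePrime_galFrob_eq` and if every prime of `K` ramified in `N` divides `𝔪`, for every `σ ∈ Gal(N/K)`
there is a prime `𝔭 ∤ 𝔪` of `K`, unramified in `N`, of residue degree one, with `N𝔭 ≤ (|d_K| n^n N𝔪)^{L(n)}`, such
that every arithmetic Frobenius at every prime of `N` above `𝔭` is `σ`. [cite: Weiss1983, §6]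
[cite: ThornerZaman2017, Theorem 3.1] -/
theorem exists_degOnePrime_frobenius_eq (n : ℕ) (hn : 1 < n) :
    ∃ L : ℝ, 0 < L ∧ ∀ (K : Type) [Field K] [NumberField K], Module.finrank ℚ K = n →
    ∀ (N : Type) [Field N] [NumberField N] [Algebra K N] [IsGalois K N],
      (∀ a b : N ≃ₐ[K] N, Commute a b) →
    ∀ (𝔪 : Ideal (𝓞 K)), 𝔪 ≠ ⊥ →
      (∀ χ : (N ≃ₐ[K] N) →* ℂˣ, ArtinKillsRay 𝔪 (fun v ↦ χ (galFrob K N v))) →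
      (∀ v : HeightOneSpectrum (𝓞 K), ¬ Algebra.IsUnramifiedIn (𝓞 N) v.asIdeal → 𝔪 ≤ v.asIdeal) →
      ∀ σ : N ≃ₐ[K] N, ∃ v : HeightOneSpectrum (𝓞 K), ¬ 𝔪 ≤ v.asIdeal ∧
        Algebra.IsUnramifiedIn (𝓞 N) v.asIdeal ∧
        (Ideal.absNorm v.asIdeal).Prime ∧ (Ideal.absNorm v.asIdeal : ℝ) ≤ rayCondQ K 𝔪 ^ L ∧
        ∀ Q ∈ v.asIdeal.primesOver (𝓞 N), ∀ φ : N ≃ₐ[K] N, IsArithFrobAt (𝓞 K) φ Q → φ = σ := by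
  obtain ⟨L, hL, h⟩ := exists_degOnePrime_galFrob_eq n hn
  refine ⟨L, hL, fun K _ _ hKn N _ _ _ _ hcomm 𝔪 h𝔪 hray hram σ ↦ ?_⟩
  obtain ⟨v, hm, hF, hpr, hle⟩ := h K hKn N hcomm 𝔪 h𝔪 hray σ
  have hunr : Algebra.IsUnramifiedIn (𝓞 N) v.asIdeal := by
    by_contra hr; exact hm (hram v hr)
  exact ⟨v, hm, hunr, hpr, hle, fun Q hQ φ hφ ↦ (eq_galFrob hcomm hunr hQ hφ).trans hF⟩

/-- **The Chebotarev–Linnik theorem for CYCLIC extensions with base-field exponent, unconditionally**: for `n > 1`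
there is `L = L(n) > 0` such that for every number field `K` of degree `n`, every finite Galois `N/K` with cyclic
group and every `σ ∈ Gal(N/K)` there is a prime `𝔭` of `K`, unramified in `N` (equivalently
`𝔭 ∤ 𝔪_{N/K} = IdeleHerbrand.admissibleModulus K N`), of residue degree one, with
`N𝔭 ≤ (|d_K| n^n N𝔪_{N/K})^L`, all of whose Frobenii are `σ`.  Artin reciprocity for the admissible modulus is
the tree's `artinKillsRay_of_finrank_le_relIndex` with `IdeleHerbrand.finrank_le_relIndex_ray_sup_normSubgroup`.
[cite: Weiss1983, §6] [cite: Childress2009, Ch. 5 §2 Thm. 2.1] -/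
theorem exists_degOnePrime_frobenius_eq_of_isCyclic (n : ℕ) (hn : 1 < n) :
    ∃ L : ℝ, 0 < L ∧ ∀ (K : Type) [Field K] [NumberField K], Module.finrank ℚ K = n →
    ∀ (N : Type) [Field N] [NumberField N] [Algebra K N] [IsGalois K N] [IsCyclic (N ≃ₐ[K] N)],
      ∀ σ : N ≃ₐ[K] N, ∃ v : HeightOneSpectrum (𝓞 K),
        ¬ IdeleHerbrand.admissibleModulus K N ≤ v.asIdeal ∧ Algebra.IsUnramifiedIn (𝓞 N) v.asIdeal ∧
        (Ideal.absNorm v.asIdeal).Prime ∧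
        (Ideal.absNorm v.asIdeal : ℝ) ≤ rayCondQ K (IdeleHerbrand.admissibleModulus K N) ^ L ∧
        ∀ Q ∈ v.asIdeal.primesOver (𝓞 N), ∀ φ : N ≃ₐ[K] N, IsArithFrobAt (𝓞 K) φ Q → φ = σ := by
  obtain ⟨L, hL, h⟩ := exists_degOnePrime_frobenius_eq n hn
  refine ⟨L, hL, fun K _ _ hKn N _ _ _ _ _ σ ↦ ?_⟩
  haveI : FiniteDimensional K N := Module.Finite.of_restrictScalars_finite ℚ K N
  have hcomm : ∀ a b : N ≃ₐ[K] N, Commute a b := fun a b ↦ IsCyclic.isMulCommutative.is_comm.comm a b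
  set 𝔪 := IdeleHerbrand.admissibleModulus K N with h𝔪def
  have h𝔪 : 𝔪 ≠ ⊥ := IdeleHerbrand.admissibleModulus_ne_bot K N
  have hiff : ∀ v : HeightOneSpectrum (𝓞 K), 𝔪 ≤ v.asIdeal ↔ ¬ Algebra.IsUnramifiedIn (𝓞 N) v.asIdeal :=
    IdeleHerbrand.admissibleModulus_le_iff (E := N)
  have hray : ∀ χ : (N ≃ₐ[K] N) →* ℂˣ, ArtinKillsRay 𝔪 (fun v ↦ χ (galFrob K N v)) := fun χ ↦
    artinKillsRay_of_finrank_le_relIndex h𝔪 (fun v hv ↦ not_not.mp fun hunr ↦ hv ((hiff v).mpr hunr))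
      (IdeleHerbrand.finrank_le_relIndex_ray_sup_normSubgroup ‹_›) χ
  exact h K hKn N hcomm 𝔪 h𝔪 hray (fun v hv ↦ (hiff v).mpr hv) σ

end Summit.QuantumAdvantage.QuantumAdvantage.Theorems.DegreeOnePrimesEscape

end
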